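import Summits.AnomalousDissipation.AnomalousDissipation.Theses.TwoAndHalfD
import Literature.Analysis.FluidPDE.TwoHalfSection
import Literature.Analysis.FluidPDE.LongTimeAverageNonneg

/-!
# P1 `stub_uniformLogStrain` — the logarithmic strain floor is UNIFORM over witness families
# (line `Sketch`, crux stmt-AnomalousDissipation-0206)

Registered tool stub (section P) of the line `Sketch` (duhamel-release) for the crux
`Summit.AnomalousDissipation.AnomalousDissipation.Theses.TwoAndHalfD.TwohalfdThesis` (= X,
stmt-AnomalousDissipation-0206).  Section O (O1 `stub_planarSubLogNoGo`, O2 `stub_eventualLogStrain`) gave, for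
every X-witness `(f, ν, u₀, u)`, a constant `c > 0` — a priori depending on the whole family — with
`c·log(1/ν_j) ≤ ⟨‖∇v_j‖₂⟩` eventually, `v_j = π_E ∘ u_j ∘ ι` the planar section.  P1 swaps the quantifiers:
for every admissible force `f`, energy level `E` and dissipation floor `ε > 0` there is ONE `c = c(f, E, ε) > 0`
that works for EVERY vanishing-viscosity family of `x₃`-invariant global Leray–Hopf solutions forced by `f` with
`meanEnergy ≤ E` and `meanDissipation ≥ ε` (the threshold in `j` stays family-dependent).

Proof (diagonal extraction, O1 as the hypothesis).  If no `c` works, then for every `n` there is a bad family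
`(ν⁽ⁿ⁾, u₀⁽ⁿ⁾, u⁽ⁿ⁾)` whose section strain is frequently `< log(1/ν_j)/(n+1)`; since also `ν⁽ⁿ⁾_j → 0`, pick an
index `J n` with `ν⁽ⁿ⁾_{J n} < 1/(n+1)`, `0 < log(1/ν⁽ⁿ⁾_{J n})` and ratio `< 1/(n+1)`.  The diagonal family
`n ↦ (ν⁽ⁿ⁾_{J n}, u₀⁽ⁿ⁾_{J n}, u⁽ⁿ⁾_{J n})` is again an X-witness for the same `f, E, ε` (all clauses are
pointwise in the index, and its viscosities tend to `0`), with section-strain ratio `→ 0` — contradicting O1.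
Supports stmt-AnomalousDissipation-0206.

## Mathlib / Literature search

`lean search 'not_eventually'`, `'Frequently.and_eventually'`, `'Frequently.exists'`,
`'tendsto_one_div_add_atTop_nhds_zero_nat'`, `'one_lt_inv₀'` (Mathlib `Filter`/`Real` API);
`'longTimeAvgSup_nonneg'` (`Literature/Analysis/FluidPDE/LongTimeAverageNonneg.lean`); `'stub_uniformLogStrain'`
(nothing); model: the landed O2 file `TwoAndHalfDTwohalfdThesisStubEventualLogStrain.lean` (p140779).
-/

noncomputable section

-- the summit path AnomalousDissipation/AnomalousDissipation duplicates a namespace component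
set_option linter.dupNamespace false

namespace Summit.AnomalousDissipation.AnomalousDissipation.Theorems.TwohalfdThesis

open MeasureTheory Set Filter Topology
open scoped ENNReal NNReal
open Literature.Analysis.FunctionSpaces Literature.Analysis.FluidPDE

/-- **P1 `stub_uniformLogStrain` — the logarithmic strain floor of section O is UNIFORM over witness families.**
`(O1, verbatim, as a hypothesis) →` for every `x₃`-invariant smooth solenoidal mean-zero steady force `f` on `T³`,
every energy level `E` and every floor `ε > 0` there is `c > 0` such that EVERY family `(ν, u₀, u)` of
`x₃`-invariant global Leray–Hopf solutions forced by `f` with `ν_j > 0`, `ν_j → 0`, `meanEnergy (u j) ≤ E` and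
`ε ≤ meanDissipation (ν j) (u j)` has `c·log(1/ν_j) ≤ ⟨‖∇v_j‖₂⟩` for all large `j`
(`v_j = π_E ∘ u_j ∘ ι`).  Diagonal extraction over bad families + O1. [folklore] -/
theorem stub_uniformLogStrain :
    (∀ f : UnitAddTorus (Fin 3) → EuclideanSpace ℝ (Fin 3),
      (∀ (s : UnitAddCircle) (x : UnitAddTorus (Fin 3)), f (x + Pi.single (2 : Fin 3) s) = f x) →
      Torus.IsSmooth f → Torus.IsDivFree f → Torus.HasZeroMean f →
      ∀ (ν : ℕ → ℝ) (u₀ : ℕ → UnitAddTorus (Fin 3) → EuclideanSpace ℝ (Fin 3))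
        (u : ℕ → ℝ → UnitAddTorus (Fin 3) → EuclideanSpace ℝ (Fin 3)),
        (∀ j, 0 < ν j) → Tendsto ν atTop (𝓝 0) →
        (∀ j, Torus.IsGlobalLerayHopf (ν j) (fun _ => f) (u₀ j) (u j)) →
        (∀ j (t : ℝ) (s : UnitAddCircle) (x : UnitAddTorus (Fin 3)),
          u j t (x + Pi.single (2 : Fin 3) s) = u j t x) →
        (∃ E : ℝ, ∀ j, meanEnergy (u j) ≤ E) →
        (∃ ε : ℝ, 0 < ε ∧ ∀ j, ε ≤ meanDissipation (ν j) (u j)) →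
        ¬ Tendsto (fun j => longTimeAvgSup (fun t => Real.sqrt (Torus.eGradNormSq
            (fun y : UnitAddTorus (Fin 2) => Torus.planarProjE (u j t (Torus.planarSect y)))).toReal) /
          Real.log (ν j)⁻¹) atTop (𝓝 0)) →
    ∀ f : UnitAddTorus (Fin 3) → EuclideanSpace ℝ (Fin 3),
      (∀ (s : UnitAddCircle) (x : UnitAddTorus (Fin 3)), f (x + Pi.single (2 : Fin 3) s) = f x) →
      Torus.IsSmooth f → Torus.IsDivFree f → Torus.HasZeroMean f →
      ∀ (E ε : ℝ), 0 < ε →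
        ∃ c : ℝ, 0 < c ∧
          ∀ (ν : ℕ → ℝ) (u₀ : ℕ → UnitAddTorus (Fin 3) → EuclideanSpace ℝ (Fin 3))
            (u : ℕ → ℝ → UnitAddTorus (Fin 3) → EuclideanSpace ℝ (Fin 3)),
            (∀ j, 0 < ν j) → Tendsto ν atTop (𝓝 0) →
            (∀ j, Torus.IsGlobalLerayHopf (ν j) (fun _ => f) (u₀ j) (u j)) →
            (∀ j (t : ℝ) (s : UnitAddCircle) (x : UnitAddTorus (Fin 3)),
              u j t (x + Pi.single (2 : Fin 3) s) = u j t x) →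
            (∀ j, meanEnergy (u j) ≤ E) → (∀ j, ε ≤ meanDissipation (ν j) (u j)) →
            ∀ᶠ j in atTop, c * Real.log (ν j)⁻¹ ≤
              longTimeAvgSup (fun t => Real.sqrt (Torus.eGradNormSq
                (fun y : UnitAddTorus (Fin 2) => Torus.planarProjE (u j t (Torus.planarSect y)))).toReal) := by
  intro hO1 f hfinv hfs hfd hfz E ε hε
  by_contra H
  -- for every `n`, a bad family at the constant `1/(n+1)`
  have H' : ∀ n : ℕ, ∃ (ν : ℕ → ℝ) (u₀ : ℕ → UnitAddTorus (Fin 3) → EuclideanSpace ℝ (Fin 3))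
      (u : ℕ → ℝ → UnitAddTorus (Fin 3) → EuclideanSpace ℝ (Fin 3)),
      (∀ j, 0 < ν j) ∧ Tendsto ν atTop (𝓝 0) ∧
      (∀ j, Torus.IsGlobalLerayHopf (ν j) (fun _ => f) (u₀ j) (u j)) ∧
      (∀ j (t : ℝ) (s : UnitAddCircle) (x : UnitAddTorus (Fin 3)),
        u j t (x + Pi.single (2 : Fin 3) s) = u j t x) ∧
      (∀ j, meanEnergy (u j) ≤ E) ∧ (∀ j, ε ≤ meanDissipation (ν j) (u j)) ∧
      ¬ ∀ᶠ j in atTop, 1 / ((n : ℝ) + 1) * Real.log (ν j)⁻¹ ≤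
        longTimeAvgSup (fun t => Real.sqrt (Torus.eGradNormSq
          (fun y : UnitAddTorus (Fin 2) => Torus.planarProjE (u j t (Torus.planarSect y)))).toReal) := by
    intro n
    by_contra Hn
    refine H ⟨1 / ((n : ℝ) + 1), Nat.one_div_pos_of_nat, fun ν u₀ u hν hν0 hLH huinv hE hfl => ?_⟩
    by_contra hev
    exact Hn ⟨ν, u₀, u, hν, hν0, hLH, huinv, hE, hfl, hev⟩
  choose ν u₀ u hν hν0 hLH huinv hE hfl hbad using H'
  -- the diagonal index: small viscosity, positive logarithm, small ratio
  have hpick : ∀ n : ℕ, ∃ j, ν n j < 1 / ((n : ℝ) + 1) ∧ 0 < Real.log (ν n j)⁻¹ ∧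
      longTimeAvgSup (fun t => Real.sqrt (Torus.eGradNormSq
          (fun y : UnitAddTorus (Fin 2) => Torus.planarProjE (u n j t (Torus.planarSect y)))).toReal) <
        1 / ((n : ℝ) + 1) * Real.log (ν n j)⁻¹ := by
    intro n
    have h1 : ∀ᶠ j in atTop, ν n j < 1 / ((n : ℝ) + 1) :=
      (hν0 n).eventually (gt_mem_nhds Nat.one_div_pos_of_nat)
    have h2 : ∀ᶠ j in atTop, 0 < Real.log (ν n j)⁻¹ := by
      filter_upwards [(hν0 n).eventually (gt_mem_nhds one_pos)] with j hj
      exact Real.log_pos ((one_lt_inv₀ (hν n j)).2 hj)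
    have h3 : ∃ᶠ j in atTop, longTimeAvgSup (fun t => Real.sqrt (Torus.eGradNormSq
          (fun y : UnitAddTorus (Fin 2) => Torus.planarProjE (u n j t (Torus.planarSect y)))).toReal) <
        1 / ((n : ℝ) + 1) * Real.log (ν n j)⁻¹ :=
      (not_eventually.1 (hbad n)).mono fun j hj => not_le.1 hj
    obtain ⟨j, hj3, hj1, hj2⟩ := (h3.and_eventually (h1.and h2)).exists
    exact ⟨j, hj1, hj2, hj3⟩
  choose J hJν hJlog hJlt using hpick
  -- the diagonal family is an X-witness for the same `f, E, ε` with vanishing strain ratio: contradiction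
  have hνJ0 : Tendsto (fun n => ν n (J n)) atTop (𝓝 0) :=
    squeeze_zero (fun n => (hν n (J n)).le) (fun n => (hJν n).le) tendsto_one_div_add_atTop_nhds_zero_nat
  refine hO1 f hfinv hfs hfd hfz (fun n => ν n (J n)) (fun n => u₀ n (J n)) (fun n => u n (J n))
    (fun n => hν n (J n)) hνJ0 (fun n => hLH n (J n)) (fun n => huinv n (J n))
    ⟨E, fun n => hE n (J n)⟩ ⟨ε, hε, fun n => hfl n (J n)⟩ ?_
  exact squeeze_zero
    (fun n => div_nonneg (longTimeAvgSup_nonneg fun t => Real.sqrt_nonneg _) (hJlog n).le)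
    (fun n => ((div_lt_iff₀ (hJlog n)).2 (hJlt n)).le) tendsto_one_div_add_atTop_nhds_zero_nat

end Summit.AnomalousDissipation.AnomalousDissipation.Theorems.TwohalfdThesis

end
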